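import Summits.BirchSwinnertonDyer.Rank1Residual.X2.KeyCongruenceInvariants
import Summits.BirchSwinnertonDyer.Rank2.LambdaCongruenceModP
import Summits.BirchSwinnertonDyer.Rank1Residual.Supersingular.MazurTateReduction
import HarnessLib

/-!
# The single-level door's analytic input `lcongr` at level `m = 1` is «equal λ»: for `μ = 0` power
# series over `Λ = ℤ_p⟦T⟧`, `(a) + (p) = (b) + (p)` holds if and only if `λ(a) = λ(b)` (cell
# `bsd-eis`, seat `bsd-eis-cgshw` g20; route `EisensteinPrimes`, crux 4 `BSDpOnCellC` / crux 3
# `MazurMCOnCellB` ∩ non-split; memo `HOME/cgshw-MEMO-23.md` §1 (a))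

HONEST FRAMING (cell `bsd-eis`, run/shared/lean/pub/bsd-eis/): pure commutative algebra of
`Λ = ℤ_p⟦T⟧`, everything PROVED (Mathlib + the tree's `X1.MuLambda` / `X2.KeyCongruence` API);
nothing booked; X2 stays CONSTRUCTION-SHAPED; no label or count moves; BSD is proved for no curve.

## The point

The single-level Hida-limit door `X2.mazurMainConjectureAt_of_singleLevelMember_of_not_split`
(`X2/HidaLimitSingleLevel.lean`) asks, of ONE congruent member of the Hida family at depth `m`,
the congruence of IDEALS `lcongr : (L) + (p)^m = (f_E) + (p)^m`. When `μ_an(E) = 0` the door is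
used at `m = 1`, and then `lcongr` is decided by the λ-invariant alone: in `Λ/p = 𝔽_p⟦T⟧` every
non-zero element is `T^λ · unit`, so two `μ = 0` elements generate the same ideal together with `p`
exactly when their reductions have the same order of vanishing, i.e. the same `λ`. The tree already
has the direction «ideal congruence ⟹ equal `μ, λ`» (`KeyCongruence.ne_zero_and_mu_eq_and_lam_eq_of_span_sup_eq`);
this file adds the converse at level one and the resulting `iff`, which is what makes a
period-free numerical λ-reading of the member (memo §§2–3) a test of `lcongr` itself.

## Contents

* §1 `red_surjective` — reduction mod `p` is onto `𝔽_p⟦T⟧` (the `μ = 0` bookkeeping is REUSED from the tree: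
  `Rank2.pfree_eq_self_of_mu_eq_zero`, `Rank2.lam_eq_toNat_order_red_of_mu_eq_zero`
  (`Rank2/LambdaCongruenceModP.lean`), `Supersingular.red_ne_zero_of_mu_eq_zero`
  (`Rank1Residual/Supersingular/MazurTateReduction.lean`)).
* §2 `mem_span_sup_span_C_of_mu_eq_zero_of_lam_eq` — `μ(a) = μ(b) = 0`, `λ(a) = λ(b)` ⟹
  `a ∈ (b) + (p)`; `span_sup_span_C_eq_of_mu_eq_zero_of_lam_eq` — the ideals `(a) + (p)` and
  `(b) + (p)` coincide; `span_sup_span_C_eq_iff_mu_eq_zero_and_lam_eq` — the `iff`.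
* §3 `lcongr_one_of_mu_eq_zero_of_lam_eq` — the door's `lcongr` field at `m = 1` in its own
  spelling (`(Ideal.span {C p}) ^ 1`).

What this is NOT: not a statement about any `L`-function or Selmer group; not a proof of `lcongr`
for any member (the member's `μ` in the canonical normalisation and its λ are INPUTS here).

References: [Washington1997] §7.1 (Weierstrass preparation; `Λ/p ≅ 𝔽_p⟦T⟧`), §13.1;
[GreenbergVatsal2000] p. 4, (1)–(2); [CastellaGrossiSkinner2025] proof of Thm. 7.2.3 (key congruence).
-/

set_option autoImplicit false
set_option linter.dupNamespace false

noncomputable section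

open Literature.NumberTheory.EllipticCurves Summit.BirchSwinnertonDyer.Rank1Residual.X1.MuLambda
  Summit.BirchSwinnertonDyer.Rank1Residual.X2.KeyCongruence
  Summit.BirchSwinnertonDyer.Rank2 Summit.BirchSwinnertonDyer.Rank1Residual.Supersingular

namespace Summit.BirchSwinnertonDyer.BirchSwinnertonDyer.Theorems.LcongrAtLevelOne

variable {p : ℕ} [Fact p.Prime]

/-! ## §1. Bookkeeping for `μ = 0` elements of `Λ` -/

/-- Reduction mod `p`, `Λ = ℤ_p⟦T⟧ → 𝔽_p⟦T⟧`, is surjective. [folklore] -/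
theorem red_surjective : Function.Surjective (red (p := p)) :=
  PowerSeries.map_surjective _ IsLocalRing.residue_surjective

/-! ## §2. Equal `λ` at `μ = 0` ⟹ the same ideal modulo `p` -/

/-- **One inclusion.** If `a, b ∈ Λ` are nonzero with `μ(a) = μ(b) = 0` and `λ(a) = λ(b)`, then
`a ∈ (b) + (p)`. Proof: in `𝔽_p⟦T⟧`, `ā = T^λ·u_a` and `b̄ = T^λ·u_b` with units `u_a, u_b`
(`PowerSeries.X_pow_order_mul_divXPowOrder`, `PowerSeries.isUnit_divided_by_X_pow_order`), so
`ā = b̄·(u_b⁻¹u_a)`; lift `u_b⁻¹u_a` to `w ∈ Λ`; then `a − b w ≡ 0 (mod p)`.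
[cite: Washington1997, §7.1] -/
theorem mem_span_sup_span_C_of_mu_eq_zero_of_lam_eq {a b : IwasawaAlgebra p} (ha : a ≠ 0)
    (hb : b ≠ 0) (hμa : mu a = 0) (hμb : mu b = 0) (hlam : lam a = lam b) :
    a ∈ Ideal.span ({b} : Set (IwasawaAlgebra p)) ⊔
      Ideal.span {(PowerSeries.C (p : ℤ_[p]) : IwasawaAlgebra p)} := by
  have hra : red a ≠ 0 := red_ne_zero_of_mu_eq_zero ha hμa
  have hrb : red b ≠ 0 := red_ne_zero_of_mu_eq_zero hb hμb
  have hord : (red a).order.toNat = (red b).order.toNat := by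
    rw [← lam_eq_toNat_order_red_of_mu_eq_zero hμa, ← lam_eq_toNat_order_red_of_mu_eq_zero hμb, hlam]
  obtain ⟨ub, hub⟩ := PowerSeries.isUnit_divided_by_X_pow_order hrb
  set w0 : PowerSeries (IsLocalRing.ResidueField ℤ_[p]) :=
    (↑ub⁻¹ : PowerSeries (IsLocalRing.ResidueField ℤ_[p])) * PowerSeries.divXPowOrder (red a)
    with hw0
  have hfac : red a = red b * w0 := by
    calc red a = PowerSeries.X ^ (red a).order.toNat * PowerSeries.divXPowOrder (red a) :=
          PowerSeries.X_pow_order_mul_divXPowOrder.symm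
      _ = PowerSeries.X ^ (red b).order.toNat * ((↑ub : PowerSeries _) * ↑ub⁻¹) *
            PowerSeries.divXPowOrder (red a) := by rw [hord, Units.mul_inv, mul_one]
      _ = (PowerSeries.X ^ (red b).order.toNat * PowerSeries.divXPowOrder (red b)) * w0 := by
          rw [hw0, hub]; ring
      _ = red b * w0 := by rw [PowerSeries.X_pow_order_mul_divXPowOrder]
  obtain ⟨w, hw⟩ := red_surjective (p := p) w0
  have hred : red (a - b * w) = 0 := by
    have : red (a - b * w) = red a - red b * red w := by
      simp only [red, map_sub, map_mul]
    rw [this, hw, hfac, sub_self]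
  rw [red_eq_zero_iff] at hred
  obtain ⟨c, hc⟩ := hred
  have hdecomp : a = w * b + c * PowerSeries.C (p : ℤ_[p]) := by linear_combination hc
  rw [hdecomp]
  exact Submodule.add_mem_sup (Ideal.mem_span_singleton'.mpr ⟨w, rfl⟩)
    (Ideal.mem_span_singleton'.mpr ⟨c, rfl⟩)

/-- **`(a) + (p) = (b) + (p)` for `μ = 0` elements with the same `λ`.** [cite: Washington1997, §7.1]
[cite: GreenbergVatsal2000, p. 4] -/
theorem span_sup_span_C_eq_of_mu_eq_zero_of_lam_eq {a b : IwasawaAlgebra p} (ha : a ≠ 0)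
    (hb : b ≠ 0) (hμa : mu a = 0) (hμb : mu b = 0) (hlam : lam a = lam b) :
    Ideal.span ({a} : Set (IwasawaAlgebra p)) ⊔ Ideal.span {(PowerSeries.C (p : ℤ_[p]))} =
      Ideal.span ({b} : Set (IwasawaAlgebra p)) ⊔ Ideal.span {(PowerSeries.C (p : ℤ_[p]))} := by
  apply le_antisymm
  · exact sup_le (Ideal.span_le.mpr (Set.singleton_subset_iff.mpr
      (mem_span_sup_span_C_of_mu_eq_zero_of_lam_eq ha hb hμa hμb hlam))) le_sup_right
  · exact sup_le (Ideal.span_le.mpr (Set.singleton_subset_iff.mpr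
      (mem_span_sup_span_C_of_mu_eq_zero_of_lam_eq hb ha hμb hμa hlam.symm))) le_sup_right

/-- **The level-one criterion (iff).** For `a ≠ 0` with `μ(a) = 0` and `b ≠ 0`:
`(a) + (p) = (b) + (p)` ⟺ `μ(b) = 0 ∧ λ(b) = λ(a)`. The forward direction is the tree's key
congruence (`KeyCongruence.ne_zero_and_mu_eq_and_lam_eq_of_span_sup_eq` at `m = 1`).
[cite: CastellaGrossiSkinner2025, proof of Thm. 7.2.3 (= arXiv Thm. 6.1.3; eq. key-cong)]
[cite: Washington1997, §7.1] -/
theorem span_sup_span_C_eq_iff_mu_eq_zero_and_lam_eq {a b : IwasawaAlgebra p} (ha : a ≠ 0)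
    (hb : b ≠ 0) (hμa : mu a = 0) :
    Ideal.span ({a} : Set (IwasawaAlgebra p)) ⊔ Ideal.span {(PowerSeries.C (p : ℤ_[p]))} =
      Ideal.span ({b} : Set (IwasawaAlgebra p)) ⊔ Ideal.span {(PowerSeries.C (p : ℤ_[p]))} ↔
    (mu b = 0 ∧ lam b = lam a) := by
  constructor
  · intro h
    have h' : Ideal.span ({a} : Set (IwasawaAlgebra p)) ⊔
        (Ideal.span {(PowerSeries.C (p : ℤ_[p]) : IwasawaAlgebra p)}) ^ 1 =
        Ideal.span ({b} : Set (IwasawaAlgebra p)) ⊔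
        (Ideal.span {(PowerSeries.C (p : ℤ_[p]) : IwasawaAlgebra p)}) ^ 1 := by
      simpa only [pow_one] using h
    have hm : mu a < 1 := by omega
    obtain ⟨-, hμ, hl⟩ := ne_zero_and_mu_eq_and_lam_eq_of_span_sup_eq ha hm h'
    exact ⟨hμ.trans hμa, hl⟩
  · rintro ⟨hμb, hl⟩
    exact span_sup_span_C_eq_of_mu_eq_zero_of_lam_eq ha hb hμa hμb hl.symm

/-! ## §3. The door's `lcongr` at `m = 1` -/

/-- **The single-level door's `lcongr` at level `1` from «`μ = 0` on both sides and equal `λ`»**, in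
the spelling of `X2.CongruentMemberData.lcongr` (`(L) + (p)^1 = (f_E) + (p)^1`): this is the exact
form in which a period-free λ-reading of the congruent member (memo §§2–3) discharges the analytic
input of `X2.mazurMainConjectureAt_of_singleLevelMember_of_not_split` when `μ_an(E) = 0`, modulo
the member's `μ` in the canonical normalisation. [cite: Washington1997, §7.1]
[cite: Skinner2016PacificMC, §3.1 (p. 192)] -/
theorem lcongr_one_of_mu_eq_zero_of_lam_eq {L fE : IwasawaAlgebra p} (hL : L ≠ 0) (hfE : fE ≠ 0)
    (hμL : mu L = 0) (hμE : mu fE = 0) (hlam : lam L = lam fE) :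
    Ideal.span ({L} : Set (IwasawaAlgebra p)) ⊔
        (Ideal.span {(PowerSeries.C (p : ℤ_[p]) : IwasawaAlgebra p)}) ^ 1 =
      Ideal.span ({fE} : Set (IwasawaAlgebra p)) ⊔
        (Ideal.span {(PowerSeries.C (p : ℤ_[p]) : IwasawaAlgebra p)}) ^ 1 := by
  rw [pow_one]
  exact span_sup_span_C_eq_of_mu_eq_zero_of_lam_eq hL hfE hμL hμE hlam

end Summit.BirchSwinnertonDyer.BirchSwinnertonDyer.Theorems.LcongrAtLevelOne

end
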